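import Summits.BirchSwinnertonDyer.BirchSwinnertonDyer.Theorems.CyclotomicUntwistF1OfGrowthCurve
import Summits.BirchSwinnertonDyer.BirchSwinnertonDyer.Theorems.CyclotomicUntwistGammaUniqueness
import Literature.NumberTheory.EllipticCurves.PAdicLFunctionProofs
import HarnessLib

/-!
# The untwisted `p`-adic `L`-function (D1) IS the explicit candidate: `μ = 𝓛_cand` for every `μ` with
# `IsUntwistedPAdicLFunction p f η α μ`; F1 ⟺ growth of the candidate; rationality over a coefficient field

Cell `pub/bsd-wall` (D-0145 line `route-BirchSwinnertonDyer-CyclotomicUntwist`), width seat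
`bsd-line-cycu-p5` g5. THEOREMS ONLY (no definition, no named fact, no `sorry`); helper `--supports`
K1 = stmt-BirchSwinnertonDyer-21580 (`PSRankOneLowerHalfAtThree`). BSD is not proved by this file and no
crux of the route is proved by it; K1/K2 stay open and WHOLE.

WHAT. D1 (`Literature.NumberTheory.IwasawaTheory.IsUntwistedPAdicLFunction p f η α μ`) is a PREDICATE on ball
values. cycu-p1's `CyclotomicUntwistF1OfGrowth` (namespace `PSF1Reduction`) writes the Mazur–Tate–Teitelbaum
construction as an EXPLICIT candidate `𝓛` (hypothesis-equations `hS hν hρ h𝓛` in the rational plus symbols of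
`f`) and proves `HasGrowthOrder p ½ 𝓛 → IsUntwistedPAdicLFunction p f η α 𝓛` (direction ⟸ of F1); cycu-p1's
`CyclotomicUntwistGammaUniqueness` (`PSGammaUniqueness.eq_of_forall_gammaCharValue_eq`) proves that ADDITIVE ball
values are determined by their values at the characters of `Γ` — WITHOUT any growth hypothesis. Putting the
two together:

* §1 `eq_candidate_of_isUntwistedPAdicLFunction` — every `μ` with the D1 property EQUALS the candidate `𝓛`
  (`η` primitive mod `p^c`, `c ≥ 1`, `α ∉ {0, p}`); hence `hasGrowthOrder_candidate_of_isUntwistedPAdicLFunction`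
  and **`exists_isUntwistedPAdicLFunction_iff_hasGrowthOrder_candidate`**: F1 (`∃ μ, D1 μ`) is EQUIVALENT to
  the growth bound `‖𝓛 n s‖ ≤ C p^{n/2}` of the explicit system, and `isUntwistedPAdicLFunction_iff`:
  `D1 μ ↔ μ = 𝓛 ∧ HasGrowthOrder p ½ 𝓛`.  Curve level (`p = 3`, `c = 2`):
  `eq_candidate_of_isPSCyclotomicLFunctionOf` (granted Carayol's `IsNewformOf.level_eq_conductorNorm`, exactly
  as `PSGammaUniqueness.eq_of_isPSCyclotomicLFunctionOf`).
* §2 RATIONALITY (Mazur–Tate–Teitelbaum §I.10: the distribution of an allowable root is `ℚ_p(α, η)`-valued;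
  D1's docstring leaves "`ℚ_p(η, α)`-rationality" to consumers). For a coefficient FIELD `K` with a ring
  homomorphism `ι : K →+* ℂ_p`, a character `η_K` mod `p^c` and a root `α_K ∈ K`: the `K`-valued candidate
  `𝓛_K` (same four equations over `K`, symbols cast `ℚ → K`) maps under `ι` to the `ℂ_p`-candidate of
  `(η_K.ringHomComp ι, ι α_K)` (`map_S`, `map_nu`, `map_rho`, `map_L`), so
  **`eq_map_candidate_of_isUntwistedPAdicLFunction`**: every D1 object for `(η_K.ringHomComp ι, ι α_K)` is
  `ι ∘ 𝓛_K`, and `exists_apply_eq_of_isUntwistedPAdicLFunction`: its ball values lie in `ι(K)`.  Curve level: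
  `eq_map_candidate_of_isPSCyclotomicLFunctionOf`.

WHY (route bookkeeping). (i) F1 (`wi-84943`) becomes ONE explicit inequality, in either direction; (ii) the
closers' `𝓛` (`…FiniteSlopeSeparated`, `…WanTyped`, `…KatoTyped`) is `ℚ₃(ζ₃, α)`-valued once it exists, the
input of the CONJUGATION statement `𝓛^{η̄} = σ ∘ 𝓛^{η}` (sequel file `CyclotomicUntwistConjugateLFunctions`),
which is the analytic face of the thesis' `σ`-symmetry `h_ψ̄ = σ h_ψ`.

References: [cite: MazurTateTeitelbaum1986Invent, §I.10–§I.11 and §I.14 (case p ∣ N)] ·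
[cite: Bellaiche2021, Thm. 6.2.13 (i) and Thm. 6.7.9].
-/

noncomputable section

open scoped MatrixGroups

open CongruenceSubgroup DirichletCharacter Literature.NumberTheory.EllipticCurves
  Literature.NumberTheory.EllipticCurves.ModularForms Literature.NumberTheory.IwasawaTheory
  Summit.BirchSwinnertonDyer.BirchSwinnertonDyer.Theorems.PSF1Reduction
  Summit.BirchSwinnertonDyer.BirchSwinnertonDyer.Theorems.PSGammaUniqueness

-- single-conjunct summit: `Summit.BirchSwinnertonDyer.BirchSwinnertonDyer.…` repeats the name by design
set_option linter.dupNamespace false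
set_option autoImplicit false

namespace Summit.BirchSwinnertonDyer.BirchSwinnertonDyer.Theorems.PSCandidateUniqueness

variable {p : ℕ} [Fact p.Prime]

/-! ### §1 D1 names the candidate: `μ = 𝓛`; F1 ⟺ growth of the candidate -/

section Candidate

variable {N : ℕ} [NeZero N] (f : CuspForm (Gamma0 N) 2)
variable {c : ℕ} (η : DirichletCharacter ℂ_[p] (p ^ c)) (α : ℂ_[p])
variable (S : (j : ℕ) → ZMod (p ^ j) → ℂ_[p])
variable (hS : ∀ (j : ℕ) (y : ZMod (p ^ j)), S j y = ∑ b : ZMod (p ^ c), η b *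
  algebraMap ℚ ℂ_[p] (ratPlusSymbol f ((y.val : ℚ) / (p : ℚ) ^ j + (b.val : ℚ) / (p : ℚ) ^ c)))
variable (ν : (M : ℕ) → ZMod (p ^ M) → ℂ_[p])
variable (hν : ∀ (M : ℕ) (x : ZMod (p ^ M)), ν M x =
  (∑ i ∈ Finset.range M, α⁻¹ ^ (i + 1) * ((p : ℂ_[p]) ^ (i + 1) / (p : ℂ_[p]) ^ M) *
      S (i + 1) ((x.val : ℕ) : ZMod (p ^ (i + 1)))) +
    ((p : ℂ_[p]) ^ M)⁻¹ * (1 - α / p)⁻¹ * S 0 0)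
variable (ρ : (M : ℕ) → ZMod (p ^ M) → ℂ_[p])
variable (hρ : ∀ (M : ℕ) (y : ZMod (p ^ M)), ρ M y = η⁻¹ ((y.val : ℕ) : ZMod (p ^ c)) * ν M y)
variable (𝓛 : (n : ℕ) → ZMod (p ^ n) → ℂ_[p])
variable (h𝓛 : ∀ (n : ℕ) (s : ZMod (p ^ n)), 𝓛 n s =
  ∑ᶠ T : rootsOfUnity (torsionOrder p) ℤ_[p],
    ∑ y ∈ Finset.univ.filter (fun y : ZMod (p ^ (c + cyclotomicExponent p + n)) ↦
      ZMod.castHom (pow_dvd_pow p (by omega : cyclotomicExponent p + n ≤ c + cyclotomicExponent p + n))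
          (ZMod (p ^ (cyclotomicExponent p + n))) y =
        PadicInt.toZModPow (cyclotomicExponent p + n) ((T : ℤ_[p]ˣ) : ℤ_[p]) *
          (cyclotomicGenerator p : ZMod (p ^ (cyclotomicExponent p + n))) ^ s.val),
      ρ (c + cyclotomicExponent p + n) y)

include hS hν hρ h𝓛 in
/-- **D1 names the candidate.** For `η` primitive mod `p^c` (`c ≥ 1`), `α ∉ {0, p}` and any cusp form `f`
on `Γ₀(N)`: every system of ball values `μ` with `IsUntwistedPAdicLFunction p f η α μ` EQUALS the explicit
untwisted Mazur–Tate–Teitelbaum candidate `𝓛` — both are additive and have the same value at every character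
of `Γ` (D1's interpolation clause for `μ`, `PSF1Reduction.gammaCharValue_candidate` for `𝓛`, the primitive `χ`
of `η̄ξ` from `PSGammaUniqueness.exists_isPrimitive_apply_eq_inv_mul`), and additive ball values are determined
by those values (`PSGammaUniqueness.eq_of_forall_gammaCharValue_eq`, no growth needed).
[cite: Bellaiche2021, Thm. 6.2.13 (i) and Thm. 6.7.9] [cite: MazurTateTeitelbaum1986Invent, §I.11 and §I.14] -/
theorem eq_candidate_of_isUntwistedPAdicLFunction (hc : 0 < c) (hη : η.IsPrimitive) (hα : α ≠ 0)
    (hαp : α ≠ p) {μ : (n : ℕ) → ZMod (p ^ n) → ℂ_[p]} (hμ : IsUntwistedPAdicLFunction p f η α μ) :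
    μ = 𝓛 :=
  eq_of_forall_gammaCharValue_eq hμ.isGammaDistribution
    (isGammaDistribution_candidate f η α S hS ν hν ρ hρ 𝓛 h𝓛 hc hη) fun m ξ hξ hξe hξo ↦ by
    obtain ⟨n, χ, hχ, hχη⟩ := exists_isPrimitive_apply_eq_inv_mul η ξ
    rw [hμ.2.2 m ξ hξ hξe hξo n χ hχ hχη,
      gammaCharValue_candidate f η α S hS ν hν ρ hρ 𝓛 h𝓛 hc hη hα hαp m ξ hξe hξo n χ hχ hχη]

include hS hν hρ h𝓛 in
/-- **F1 ⟹ GROWTH**: if some `μ` has the D1 property, the explicit candidate has growth order `½` (it IS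
that `μ`). [cite: Bellaiche2021, Thm. 6.7.9 (growth rate)] [cite: MazurTateTeitelbaum1986Invent, §I.14] -/
theorem hasGrowthOrder_candidate_of_isUntwistedPAdicLFunction (hc : 0 < c) (hη : η.IsPrimitive)
    (hα : α ≠ 0) (hαp : α ≠ p) {μ : (n : ℕ) → ZMod (p ^ n) → ℂ_[p]}
    (hμ : IsUntwistedPAdicLFunction p f η α μ) : HasGrowthOrder p (1 / 2) 𝓛 :=
  eq_candidate_of_isUntwistedPAdicLFunction f η α S hS ν hν ρ hρ 𝓛 h𝓛 hc hη hα hαp hμ ▸ hμ.hasGrowthOrder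

include hS hν hρ h𝓛 in
/-- **F1 ⟺ GROWTH OF THE CANDIDATE.** For `η` primitive mod `p^c` (`c ≥ 1`), `α ∉ {0, p}`: an untwisted
`p`-adic `L`-function `𝓛^η_f` in the sense of D1 EXISTS iff the explicit candidate satisfies
`‖𝓛 n s‖ ≤ C · p^{n/2}` (⟸ is cycu-p1's `isUntwistedPAdicLFunction_of_hasGrowthOrder`; ⟹ is uniqueness).
So the route's want F1 (`wi-84943`) is literally this one inequality for this one system.
[cite: MazurTateTeitelbaum1986Invent, §I.14 (case p ∣ N, a_p ≠ 0)] [cite: Bellaiche2021, Thm. 6.7.9] -/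
theorem exists_isUntwistedPAdicLFunction_iff_hasGrowthOrder_candidate (hc : 0 < c) (hη : η.IsPrimitive)
    (hα : α ≠ 0) (hαp : α ≠ p) :
    (∃ μ : (n : ℕ) → ZMod (p ^ n) → ℂ_[p], IsUntwistedPAdicLFunction p f η α μ) ↔
      HasGrowthOrder p (1 / 2) 𝓛 :=
  ⟨fun ⟨_, hμ⟩ ↦
      hasGrowthOrder_candidate_of_isUntwistedPAdicLFunction f η α S hS ν hν ρ hρ 𝓛 h𝓛 hc hη hα hαp hμ,
    fun h ↦ ⟨𝓛, isUntwistedPAdicLFunction_of_hasGrowthOrder f η α S hS ν hν ρ hρ 𝓛 h𝓛 hc hη hα hαp h⟩⟩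

include hS hν hρ h𝓛 in
/-- **The D1 predicate, solved**: `IsUntwistedPAdicLFunction p f η α μ ↔ (μ = 𝓛 ∧ HasGrowthOrder p ½ 𝓛)`.
[cite: MazurTateTeitelbaum1986Invent, §I.14] [cite: Bellaiche2021, Thm. 6.2.13 and Thm. 6.7.9] -/
theorem isUntwistedPAdicLFunction_iff_eq_candidate (hc : 0 < c) (hη : η.IsPrimitive) (hα : α ≠ 0)
    (hαp : α ≠ p) (μ : (n : ℕ) → ZMod (p ^ n) → ℂ_[p]) :
    IsUntwistedPAdicLFunction p f η α μ ↔ μ = 𝓛 ∧ HasGrowthOrder p (1 / 2) 𝓛 := by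
  refine ⟨fun hμ ↦ ⟨eq_candidate_of_isUntwistedPAdicLFunction f η α S hS ν hν ρ hρ 𝓛 h𝓛 hc hη hα hαp hμ,
    hasGrowthOrder_candidate_of_isUntwistedPAdicLFunction f η α S hS ν hν ρ hρ 𝓛 h𝓛 hc hη hα hαp hμ⟩,
    ?_⟩
  rintro ⟨rfl, h⟩
  exact isUntwistedPAdicLFunction_of_hasGrowthOrder f η α S hS ν hν ρ hρ _ h𝓛 hc hη hα hαp h

end Candidate

/-! ### §1b Curve level (`p = 3`, `c = 2`) -/

section Curve

variable {W : WeierstrassCurve ℚ} [W.IsElliptic] {N : ℕ} [NeZero N] {f : CuspForm (Gamma0 N) 2}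
variable (η : DirichletCharacter ℂ_[3] (3 ^ 2)) (α : ℂ_[3])
variable (S : (j : ℕ) → ZMod (3 ^ j) → ℂ_[3])
variable (hS : ∀ (j : ℕ) (y : ZMod (3 ^ j)), S j y = ∑ b : ZMod (3 ^ 2), η b *
  algebraMap ℚ ℂ_[3] (ratPlusSymbol f ((y.val : ℚ) / (3 : ℚ) ^ j + (b.val : ℚ) / (3 : ℚ) ^ 2)))
variable (ν : (M : ℕ) → ZMod (3 ^ M) → ℂ_[3])
variable (hν : ∀ (M : ℕ) (x : ZMod (3 ^ M)), ν M x =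
  (∑ i ∈ Finset.range M, α⁻¹ ^ (i + 1) * (((3 : ℕ) : ℂ_[3]) ^ (i + 1) / ((3 : ℕ) : ℂ_[3]) ^ M) *
      S (i + 1) ((x.val : ℕ) : ZMod (3 ^ (i + 1)))) +
    (((3 : ℕ) : ℂ_[3]) ^ M)⁻¹ * (1 - α / (3 : ℕ))⁻¹ * S 0 0)
variable (ρ : (M : ℕ) → ZMod (3 ^ M) → ℂ_[3])
variable (hρ : ∀ (M : ℕ) (y : ZMod (3 ^ M)), ρ M y = η⁻¹ ((y.val : ℕ) : ZMod (3 ^ 2)) * ν M y)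
variable (𝓛 : (n : ℕ) → ZMod (3 ^ n) → ℂ_[3])
variable (h𝓛 : ∀ (n : ℕ) (s : ZMod (3 ^ n)), 𝓛 n s =
  ∑ᶠ T : rootsOfUnity (torsionOrder 3) ℤ_[3],
    ∑ y ∈ Finset.univ.filter (fun y : ZMod (3 ^ (2 + cyclotomicExponent 3 + n)) ↦
      ZMod.castHom (pow_dvd_pow 3 (by omega : cyclotomicExponent 3 + n ≤ 2 + cyclotomicExponent 3 + n))
          (ZMod (3 ^ (cyclotomicExponent 3 + n))) y =
        PadicInt.toZModPow (cyclotomicExponent 3 + n) ((T : ℤ_[3]ˣ) : ℤ_[3]) *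
          (cyclotomicGenerator 3 : ZMod (3 ^ (cyclotomicExponent 3 + n))) ^ s.val),
      ρ (2 + cyclotomicExponent 3 + n) y)

include hS hν hρ h𝓛 in
/-- **`𝓛^η_W` is the candidate** (curve level): granted Carayol's level statement (tree named fact
`IsNewformOf.level_eq_conductorNorm`, hypothesis `hlev`, as in `PSGammaUniqueness.eq_of_isPSCyclotomicLFunctionOf`
— it identifies the hidden newform of `IsPSCyclotomicLFunctionOf` with `f` by multiplicity one), every `μ` with
`IsPSCyclotomicLFunctionOf W η α μ` equals the explicit candidate built on the newform `f` of `W`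
(`η` primitive mod `9`, `α ∉ {0, 3}`). [cite: MazurTateTeitelbaum1986Invent, §I.14 (case p ∣ N)] [cite: Carayol1986] -/
theorem eq_candidate_of_isPSCyclotomicLFunctionOf
    (hlev : ∀ (M : ℕ) [NeZero M], IsNewformOf.level_eq_conductorNorm (N := M))
    (hf : IsNewformOf W f) (hη : η.IsPrimitive) (hα : α ≠ 0) (hα3 : α ≠ (3 : ℕ))
    {μ : (n : ℕ) → ZMod (3 ^ n) → ℂ_[3]} (hμ : IsPSCyclotomicLFunctionOf W η α μ) : μ = 𝓛 := by
  obtain ⟨N', _, f', hf', hL'⟩ := hμ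
  obtain rfl : N = W.conductorNorm ℤ := hlev N hf
  obtain rfl : N' = W.conductorNorm ℤ := hlev N' hf'
  obtain rfl : f = f' := hf.unique hf'
  exact eq_candidate_of_isUntwistedPAdicLFunction (p := 3) f η α S hS ν hν ρ hρ 𝓛 h𝓛 (by norm_num) hη hα
    hα3 hL'

include hS hν hρ h𝓛 in
/-- **F1 for the curve ⟺ growth of the candidate** (granted Carayol's level statement for ⟹):
`(∃ μ, IsPSCyclotomicLFunctionOf W η α μ) ↔ HasGrowthOrder 3 ½ 𝓛` for the newform `f` of `W`, `η` primitive
mod `9`, `α ∉ {0, 3}`. [cite: MazurTateTeitelbaum1986Invent, §I.14 (case p ∣ N)] [cite: Carayol1986] -/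
theorem exists_isPSCyclotomicLFunctionOf_iff_hasGrowthOrder_candidate
    (hlev : ∀ (M : ℕ) [NeZero M], IsNewformOf.level_eq_conductorNorm (N := M))
    (hf : IsNewformOf W f) (hη : η.IsPrimitive) (hα : α ≠ 0) (hα3 : α ≠ (3 : ℕ)) :
    (∃ μ : (n : ℕ) → ZMod (3 ^ n) → ℂ_[3], IsPSCyclotomicLFunctionOf W η α μ) ↔
      HasGrowthOrder 3 (1 / 2) 𝓛 := by
  refine ⟨fun ⟨μ, hμ⟩ ↦ ?_, fun h ↦ ⟨𝓛, PSF1Curve.isPSCyclotomicLFunctionOf_of_hasGrowthOrder η α S hS ν hν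
    ρ hρ 𝓛 h𝓛 hf hη hα hα3 h⟩⟩
  rw [← eq_candidate_of_isPSCyclotomicLFunctionOf η α S hS ν hν ρ hρ 𝓛 h𝓛 hlev hf hη hα hα3 hμ]
  exact hμ.isGammaDistribution_and_hasGrowthOrder.2

end Curve

/-! ### §2 Rationality: over a coefficient field `K`, `ι : K →+* ℂ_p`, the candidate is `ι ∘ 𝓛_K` -/

section Rational

variable {K : Type*} [Field K] (ι : K →+* ℂ_[p])
variable {N : ℕ} [NeZero N] (f : CuspForm (Gamma0 N) 2)
variable {c : ℕ} (ηK : DirichletCharacter K (p ^ c)) (αK : K)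
variable (SK : (j : ℕ) → ZMod (p ^ j) → K)
variable (hSK : ∀ (j : ℕ) (y : ZMod (p ^ j)), SK j y = ∑ b : ZMod (p ^ c), ηK b *
  ((ratPlusSymbol f ((y.val : ℚ) / (p : ℚ) ^ j + (b.val : ℚ) / (p : ℚ) ^ c) : ℚ) : K))
variable (νK : (M : ℕ) → ZMod (p ^ M) → K)
variable (hνK : ∀ (M : ℕ) (x : ZMod (p ^ M)), νK M x =
  (∑ i ∈ Finset.range M, αK⁻¹ ^ (i + 1) * ((p : K) ^ (i + 1) / (p : K) ^ M) *
      SK (i + 1) ((x.val : ℕ) : ZMod (p ^ (i + 1)))) +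
    ((p : K) ^ M)⁻¹ * (1 - αK / p)⁻¹ * SK 0 0)
variable (ρK : (M : ℕ) → ZMod (p ^ M) → K)
variable (hρK : ∀ (M : ℕ) (y : ZMod (p ^ M)), ρK M y = ηK⁻¹ ((y.val : ℕ) : ZMod (p ^ c)) * νK M y)
variable (𝓛K : (n : ℕ) → ZMod (p ^ n) → K)
variable (h𝓛K : ∀ (n : ℕ) (s : ZMod (p ^ n)), 𝓛K n s =
  ∑ᶠ T : rootsOfUnity (torsionOrder p) ℤ_[p],
    ∑ y ∈ Finset.univ.filter (fun y : ZMod (p ^ (c + cyclotomicExponent p + n)) ↦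
      ZMod.castHom (pow_dvd_pow p (by omega : cyclotomicExponent p + n ≤ c + cyclotomicExponent p + n))
          (ZMod (p ^ (cyclotomicExponent p + n))) y =
        PadicInt.toZModPow (cyclotomicExponent p + n) ((T : ℤ_[p]ˣ) : ℤ_[p]) *
          (cyclotomicGenerator p : ZMod (p ^ (cyclotomicExponent p + n))) ^ s.val),
      ρK (c + cyclotomicExponent p + n) y)

omit [NeZero N] in
include hSK in
/-- `ι` maps the `K`-valued twisted symbols `S_K` to the `ℂ_p`-valued ones of `η_K.ringHomComp ι` (the plus
symbols are rational). [cite: MazurTateTeitelbaum1986Invent, §I.10] -/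
theorem map_S (j : ℕ) (y : ZMod (p ^ j)) :
    ι (SK j y) = ∑ b : ZMod (p ^ c), (ηK.ringHomComp ι) b *
      algebraMap ℚ ℂ_[p] (ratPlusSymbol f ((y.val : ℚ) / (p : ℚ) ^ j + (b.val : ℚ) / (p : ℚ) ^ c)) := by
  rw [hSK, map_sum]
  refine Finset.sum_congr rfl fun b _ ↦ ?_
  rw [map_mul, MulChar.ringHomComp_apply, map_ratCast, eq_ratCast]

include hνK in
/-- `ι` maps `ν_K` to the `ν` of `(η_K.ringHomComp ι, ι α_K)`. [cite: MazurTateTeitelbaum1986Invent, §I.10] -/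
theorem map_nu (M : ℕ) (x : ZMod (p ^ M)) :
    ι (νK M x) =
      (∑ i ∈ Finset.range M, (ι αK)⁻¹ ^ (i + 1) * ((p : ℂ_[p]) ^ (i + 1) / (p : ℂ_[p]) ^ M) *
          ι (SK (i + 1) ((x.val : ℕ) : ZMod (p ^ (i + 1))))) +
        ((p : ℂ_[p]) ^ M)⁻¹ * (1 - ι αK / p)⁻¹ * ι (SK 0 0) := by
  rw [hνK]
  simp only [map_add, map_sum, map_mul, map_pow, map_inv₀, map_div₀, map_natCast, map_sub, map_one]

include hρK in
/-- `ι` maps `ρ_K = η̄_K ν_K` to the `ρ` of `η_K.ringHomComp ι`. [cite: MazurTateTeitelbaum1986Invent, §I.11] -/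
theorem map_rho (M : ℕ) (y : ZMod (p ^ M)) :
    ι (ρK M y) = (ηK.ringHomComp ι)⁻¹ ((y.val : ℕ) : ZMod (p ^ c)) * ι (νK M y) := by
  rw [hρK, map_mul, MulChar.ringHomComp_inv, MulChar.ringHomComp_apply]

include h𝓛K in
/-- `ι` maps the `K`-valued pushforward `𝓛_K` to the pushforward of `ι ∘ ρ_K` (finite sums).
[cite: MazurTateTeitelbaum1986Invent, §I.13] -/
theorem map_L (n : ℕ) (s : ZMod (p ^ n)) :
    ι (𝓛K n s) =
      ∑ᶠ T : rootsOfUnity (torsionOrder p) ℤ_[p],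
        ∑ y ∈ Finset.univ.filter (fun y : ZMod (p ^ (c + cyclotomicExponent p + n)) ↦
          ZMod.castHom (pow_dvd_pow p (by omega : cyclotomicExponent p + n ≤ c + cyclotomicExponent p + n))
              (ZMod (p ^ (cyclotomicExponent p + n))) y =
            PadicInt.toZModPow (cyclotomicExponent p + n) ((T : ℤ_[p]ˣ) : ℤ_[p]) *
              (cyclotomicGenerator p : ZMod (p ^ (cyclotomicExponent p + n))) ^ s.val),
          ι (ρK (c + cyclotomicExponent p + n) y) := by
  classical
  haveI := neZero_torsionOrder p
  haveI := Fintype.ofFinite (rootsOfUnity (torsionOrder p) ℤ_[p])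
  rw [h𝓛K, finsum_eq_sum_of_fintype, finsum_eq_sum_of_fintype, map_sum]
  refine Finset.sum_congr rfl fun T _ ↦ ?_
  rw [map_sum]

include hSK hνK hρK h𝓛K in
/-- **RATIONALITY: D1 names `ι ∘ 𝓛_K`.** For a coefficient field `K` with `ι : K →+* ℂ_p`, `η_K`
primitive mod `p^c` (`c ≥ 1`) and `α_K ∈ K` with `ι α_K ∉ {0, p}`: every `μ` with
`IsUntwistedPAdicLFunction p f (η_K.ringHomComp ι) (ι α_K) μ` is `ι ∘ 𝓛_K` for the `K`-valued candidate —
the untwisted `L`-function is `ℚ_p(η, α)`-valued (Mazur–Tate–Teitelbaum §I.10; the promise of D1's docstring).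
[cite: MazurTateTeitelbaum1986Invent, §I.10 and §I.14] [cite: Bellaiche2021, Thm. 6.2.13 (i)] -/
theorem eq_map_candidate_of_isUntwistedPAdicLFunction (hc : 0 < c) (hη : ηK.IsPrimitive)
    (hα : ι αK ≠ 0) (hαp : ι αK ≠ p) {μ : (n : ℕ) → ZMod (p ^ n) → ℂ_[p]}
    (hμ : IsUntwistedPAdicLFunction p f (ηK.ringHomComp ι) (ι αK) μ) :
    μ = fun n s ↦ ι (𝓛K n s) :=
  eq_candidate_of_isUntwistedPAdicLFunction f (ηK.ringHomComp ι) (ι αK) (fun j y ↦ ι (SK j y))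
    (map_S ι f ηK SK hSK) (fun M x ↦ ι (νK M x)) (map_nu ι αK SK νK hνK)
    (fun M y ↦ ι (ρK M y)) (map_rho ι ηK νK ρK hρK) (fun n s ↦ ι (𝓛K n s)) (map_L ι ρK 𝓛K h𝓛K) hc
    ((isPrimitive_ringHomComp_iff ι ηK).mpr hη) hα hαp hμ

include hSK hνK hρK h𝓛K in
/-- **F1 over `K` ⟺ growth of `ι ∘ 𝓛_K`.** [cite: MazurTateTeitelbaum1986Invent, §I.14] [cite: Bellaiche2021, Thm. 6.7.9] -/
theorem exists_isUntwistedPAdicLFunction_iff_hasGrowthOrder_map_candidate (hc : 0 < c)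
    (hη : ηK.IsPrimitive) (hα : ι αK ≠ 0) (hαp : ι αK ≠ p) :
    (∃ μ : (n : ℕ) → ZMod (p ^ n) → ℂ_[p], IsUntwistedPAdicLFunction p f (ηK.ringHomComp ι) (ι αK) μ) ↔
      HasGrowthOrder p (1 / 2) (fun n s ↦ ι (𝓛K n s)) :=
  exists_isUntwistedPAdicLFunction_iff_hasGrowthOrder_candidate f (ηK.ringHomComp ι) (ι αK)
    (fun j y ↦ ι (SK j y)) (map_S ι f ηK SK hSK) (fun M x ↦ ι (νK M x))
    (map_nu ι αK SK νK hνK) (fun M y ↦ ι (ρK M y)) (map_rho ι ηK νK ρK hρK)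
    (fun n s ↦ ι (𝓛K n s)) (map_L ι ρK 𝓛K h𝓛K) hc ((isPrimitive_ringHomComp_iff ι ηK).mpr hη) hα hαp

/-- **Ball values lie in `ι(K)`**: with `η = η_K.ringHomComp ι`, `α = ι α_K` as above, every D1 object `μ`
satisfies `μ n s ∈ ι(K)` for all `n`, `s` — i.e. `μ = ι ∘ μ_K` for SOME `K`-valued system (the candidate,
instantiated). [cite: MazurTateTeitelbaum1986Invent, §I.10] -/
theorem exists_apply_eq_of_isUntwistedPAdicLFunction (hc : 0 < c) (hη : ηK.IsPrimitive) (hα : ι αK ≠ 0)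
    (hαp : ι αK ≠ p) {μ : (n : ℕ) → ZMod (p ^ n) → ℂ_[p]}
    (hμ : IsUntwistedPAdicLFunction p f (ηK.ringHomComp ι) (ι αK) μ) :
    ∃ μK : (n : ℕ) → ZMod (p ^ n) → K, μ = fun n s ↦ ι (μK n s) := by
  classical
  -- instantiate the `K`-valued candidate by its defining formulas
  set SK' : (j : ℕ) → ZMod (p ^ j) → K := fun j y ↦ ∑ b : ZMod (p ^ c), ηK b *
    ((ratPlusSymbol f ((y.val : ℚ) / (p : ℚ) ^ j + (b.val : ℚ) / (p : ℚ) ^ c) : ℚ) : K) with hSK'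
  set νK' : (M : ℕ) → ZMod (p ^ M) → K := fun M x ↦
    (∑ i ∈ Finset.range M, αK⁻¹ ^ (i + 1) * ((p : K) ^ (i + 1) / (p : K) ^ M) *
        SK' (i + 1) ((x.val : ℕ) : ZMod (p ^ (i + 1)))) +
      ((p : K) ^ M)⁻¹ * (1 - αK / p)⁻¹ * SK' 0 0 with hνK'
  set ρK' : (M : ℕ) → ZMod (p ^ M) → K := fun M y ↦ ηK⁻¹ ((y.val : ℕ) : ZMod (p ^ c)) * νK' M y
    with hρK'
  set 𝓛K' : (n : ℕ) → ZMod (p ^ n) → K := fun n s ↦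
    ∑ᶠ T : rootsOfUnity (torsionOrder p) ℤ_[p],
      ∑ y ∈ Finset.univ.filter (fun y : ZMod (p ^ (c + cyclotomicExponent p + n)) ↦
        ZMod.castHom (pow_dvd_pow p (by omega : cyclotomicExponent p + n ≤ c + cyclotomicExponent p + n))
            (ZMod (p ^ (cyclotomicExponent p + n))) y =
          PadicInt.toZModPow (cyclotomicExponent p + n) ((T : ℤ_[p]ˣ) : ℤ_[p]) *
            (cyclotomicGenerator p : ZMod (p ^ (cyclotomicExponent p + n))) ^ s.val),
        ρK' (c + cyclotomicExponent p + n) y with h𝓛K'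
  exact ⟨𝓛K', eq_map_candidate_of_isUntwistedPAdicLFunction ι f ηK αK SK' (fun _ _ ↦ rfl) νK'
    (fun _ _ ↦ rfl) ρK' (fun _ _ ↦ rfl) 𝓛K' (fun _ _ ↦ rfl) hc hη hα hαp hμ⟩

end Rational

/-! ### §2b Curve level (`p = 3`, `c = 2`) over a coefficient field -/

section RationalCurve

variable {K : Type*} [Field K] (ι : K →+* ℂ_[3])
variable {W : WeierstrassCurve ℚ} [W.IsElliptic] {N : ℕ} [NeZero N] {f : CuspForm (Gamma0 N) 2}
variable (ηK : DirichletCharacter K (3 ^ 2)) (αK : K)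
variable (SK : (j : ℕ) → ZMod (3 ^ j) → K)
variable (hSK : ∀ (j : ℕ) (y : ZMod (3 ^ j)), SK j y = ∑ b : ZMod (3 ^ 2), ηK b *
  ((ratPlusSymbol f ((y.val : ℚ) / (3 : ℚ) ^ j + (b.val : ℚ) / (3 : ℚ) ^ 2) : ℚ) : K))
variable (νK : (M : ℕ) → ZMod (3 ^ M) → K)
variable (hνK : ∀ (M : ℕ) (x : ZMod (3 ^ M)), νK M x =
  (∑ i ∈ Finset.range M, αK⁻¹ ^ (i + 1) * (((3 : ℕ) : K) ^ (i + 1) / ((3 : ℕ) : K) ^ M) *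
      SK (i + 1) ((x.val : ℕ) : ZMod (3 ^ (i + 1)))) +
    (((3 : ℕ) : K) ^ M)⁻¹ * (1 - αK / (3 : ℕ))⁻¹ * SK 0 0)
variable (ρK : (M : ℕ) → ZMod (3 ^ M) → K)
variable (hρK : ∀ (M : ℕ) (y : ZMod (3 ^ M)), ρK M y = ηK⁻¹ ((y.val : ℕ) : ZMod (3 ^ 2)) * νK M y)
variable (𝓛K : (n : ℕ) → ZMod (3 ^ n) → K)
variable (h𝓛K : ∀ (n : ℕ) (s : ZMod (3 ^ n)), 𝓛K n s =
  ∑ᶠ T : rootsOfUnity (torsionOrder 3) ℤ_[3],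
    ∑ y ∈ Finset.univ.filter (fun y : ZMod (3 ^ (2 + cyclotomicExponent 3 + n)) ↦
      ZMod.castHom (pow_dvd_pow 3 (by omega : cyclotomicExponent 3 + n ≤ 2 + cyclotomicExponent 3 + n))
          (ZMod (3 ^ (cyclotomicExponent 3 + n))) y =
        PadicInt.toZModPow (cyclotomicExponent 3 + n) ((T : ℤ_[3]ˣ) : ℤ_[3]) *
          (cyclotomicGenerator 3 : ZMod (3 ^ (cyclotomicExponent 3 + n))) ^ s.val),
      ρK (2 + cyclotomicExponent 3 + n) y)

include hSK hνK hρK h𝓛K in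
/-- **`𝓛^η_W = ι ∘ 𝓛_K`** (curve level, granted Carayol's level statement `hlev` as in §1b): for the newform
`f` of `W`, a coefficient field `K` with `ι : K →+* ℂ₃`, `η_K` primitive mod `9`, `ι α_K ∉ {0, 3}`, every `μ`
with `IsPSCyclotomicLFunctionOf W (η_K.ringHomComp ι) (ι α_K) μ` is `ι ∘ 𝓛_K` — in particular
`ℚ₃(ζ₃, α)`-valued for the route's `K = ℚ₃(ζ₃) ∋ α`. [cite: MazurTateTeitelbaum1986Invent, §I.10 and §I.14] [cite: Carayol1986] -/
theorem eq_map_candidate_of_isPSCyclotomicLFunctionOf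
    (hlev : ∀ (M : ℕ) [NeZero M], IsNewformOf.level_eq_conductorNorm (N := M))
    (hf : IsNewformOf W f) (hη : ηK.IsPrimitive) (hα : ι αK ≠ 0) (hα3 : ι αK ≠ (3 : ℕ))
    {μ : (n : ℕ) → ZMod (3 ^ n) → ℂ_[3]} (hμ : IsPSCyclotomicLFunctionOf W (ηK.ringHomComp ι) (ι αK) μ) :
    μ = fun n s ↦ ι (𝓛K n s) := by
  obtain ⟨N', _, f', hf', hL'⟩ := hμ
  obtain rfl : N = W.conductorNorm ℤ := hlev N hf
  obtain rfl : N' = W.conductorNorm ℤ := hlev N' hf'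
  obtain rfl : f = f' := hf.unique hf'
  exact eq_map_candidate_of_isUntwistedPAdicLFunction (p := 3) ι f ηK αK SK hSK νK hνK ρK hρK 𝓛K h𝓛K
    (by norm_num) hη hα hα3 hL'

end RationalCurve

end Summit.BirchSwinnertonDyer.BirchSwinnertonDyer.Theorems.PSCandidateUniqueness

end
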